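import Summits.QuantumFields.YangMills.Theorems.LuscherReductionTwistedTraceScalingBOCurrencyFloor
import HarnessLib

/-!
# (C4-CORE currency, absolute, with the colour normalisation kept) `c_R·β^{-K}·e^{4β|E|}·fpZ(β^{-1})^{-2}·‖φ‖² ≤ Λ(β)²·T(φ)`, eventually in `β`
# (lane A of S-BASE, crux `TwistedTraceScaling` stmt-QuantumFields-20203, C4-CORE, the (OD) pen; `pub/ym-fleet/ym-luscher-20007-p1/HANDOFF-g20.md` (β))

The (OD) assembly `…BODefect.hOD_of_defect` wants the defect bounded by `(b·Λ)²·T`, `Λ = (btC/fpZ/γ)·λ₀(L³β)`, `T = tubeNormSq w (boFun φ Ω_c)`; the three NON-core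
pieces of `…BODefectSplit.sq_integral_defect_split_le` (FP tail, outer region, shell of the dual BO function) are bounded ABSOLUTELY by `X_i(β)·‖φ‖²`.  This file converts:
★★ `currency_floor_inv` — the variant of `…BOCurrencyFloor.currency_floor` KEEPING the factor `(fpZ ε)^{-2} ≥ 1` of `Λ²` on the left (needed by the dual-BO shell piece, whose
absolute bound carries `(fpZ ε)^{-2}` itself): eventually `c_R·(β^{-1})^K·(e^{2β})^{2|E|}·(fpZ(β^{-1}))^{-2}·∫φ² ≤ Λ(β)²·T(φ)`.  Ingredients: `T ≥ (1−C_qδ²)γ‖φ‖²` (`…BORecordGamma.tubeNormSq_record_ge`), `btC ≥ C₁β^{-K₁}`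
(`…BOBtCPolyFloor.btC_record_poly_floor`), `λ₀(B) ≥ e^{6B}e^{-3}B^{-9/2}/2000` (`…BTTopValue.levelValue_one_site_zero_ge`, `e^{6L³β} = (e^{2β})^{|E|}`), `fpZ ≤ 1`,
`γ ≤ N̄(1)·π(univ)` (`recordGamma_eq`, `fpWeightBar_mono`).  Hence each absolute piece is a RATE `b_i² = X_i/(c_Rβ^{-K}e^{4β|E|})`, super-polynomially small for the
pieces of record (`X_i ∝ e^{4β|E|}e^{−cℓ²}`).
HONEST FRAMING: bookkeeping for a stub of a child of the CONDITIONAL route R2b1; the hOD assembly, (B-ST), C4-CORE remain OPEN; not a gap, not Clay.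
-/

set_option autoImplicit false

noncomputable section

open MeasureTheory Filter Topology Real
open scoped BigOperators
open Literature.MathematicalPhysics.QuantumFieldTheory
open Literature.MathematicalPhysics.QuantumLattice

namespace Summit.QuantumFields.YangMills.Theorems.FemtoTransferGap.TwoLattice.ConstTube

open Summit.QuantumFields.YangMills.Theorems.FemtoTransferGap
open Summit.QuantumFields.YangMills.Theorems.FemtoTransferGap.TwoLattice
open Summit.QuantumFields.YangMills.Theorems.FemtoTransferGap.TwoLattice.Avg
open Summit.QuantumFields.YangMills.Theorems.FemtoTransferGap.TwoLattice.Stiff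
open Summit.QuantumFields.YangMills.Theorems.FemtoTransferGap.TwoLattice.GnChart
open Summit.QuantumFields.YangMills.Theorems.FemtoTransferGap.TwoLattice.Cov

variable {L : ℕ} [NeZero L]

/-- Pure algebra of the floor with `Z⁻²` kept. [folklore] -/
theorem currency_floor_alg_inv {btC C₁K lam lamF Z γ G T I : ℝ} (hC₁K : 0 ≤ C₁K) (hbtC : C₁K ≤ btC) (hlamF : 0 ≤ lamF) (hlam : lamF ≤ lam)
    (hZ0 : 0 < Z) (hγ0 : 0 < γ) (hγG : γ ≤ G) (hI : 0 ≤ I) (hT : 1 / 2 * γ * I ≤ T) :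
    C₁K ^ 2 * lamF ^ 2 / (2 * G) * Z⁻¹ ^ 2 * I ≤ (btC / Z / γ * lam) ^ 2 * T := by
  have hG0 : 0 < G := lt_of_lt_of_le hγ0 hγG
  have h1 : C₁K ^ 2 ≤ btC ^ 2 := pow_le_pow_left₀ hC₁K hbtC 2
  have h2 : lamF ^ 2 ≤ lam ^ 2 := pow_le_pow_left₀ hlamF hlam 2
  have h3 : 1 / (2 * G) ≤ 1 / (2 * γ) := one_div_le_one_div_of_le (by positivity) (by linarith)
  have h4 : Z⁻¹ ^ 2 = 1 / Z ^ 2 := by rw [inv_pow, one_div]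
  have hbtC0 : 0 ≤ btC := hC₁K.trans hbtC
  have hprod : C₁K ^ 2 * lamF ^ 2 * (1 / (2 * G)) ≤ btC ^ 2 * lam ^ 2 * (1 / (2 * γ)) :=
    mul_le_mul (mul_le_mul h1 h2 (sq_nonneg _) (sq_nonneg _)) h3 (by positivity) (by positivity)
  have hΛ : btC ^ 2 * lam ^ 2 * (1 / (2 * γ)) * (1 / Z ^ 2) * I = (btC / Z / γ * lam) ^ 2 * (1 / 2 * γ * I) := by
    field_simp
  calc C₁K ^ 2 * lamF ^ 2 / (2 * G) * Z⁻¹ ^ 2 * I = C₁K ^ 2 * lamF ^ 2 * (1 / (2 * G)) * (1 / Z ^ 2) * I := by rw [h4]; ring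
    _ ≤ btC ^ 2 * lam ^ 2 * (1 / (2 * γ)) * (1 / Z ^ 2) * I := mul_le_mul_of_nonneg_right (mul_le_mul_of_nonneg_right hprod (by positivity)) hI
    _ = (btC / Z / γ * lam) ^ 2 * (1 / 2 * γ * I) := hΛ
    _ ≤ (btC / Z / γ * lam) ^ 2 * T := mul_le_mul_of_nonneg_left hT (sq_nonneg _)

set_option maxHeartbeats 800000 in
-- long record expressions.
/-- ★★ **THE ABSOLUTE CURRENCY FLOOR WITH `fpZ^{-2}` KEPT** (see the module docstring). [cite: Luscher1983, §3] -/
theorem currency_floor_inv (hLz : Nonempty (NzSite L)) {s : ℝ} (hs : 0 < s) (hs3 : s ≤ 1 / 3) :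
    ∃ M₀ : ℝ, 2 ≤ M₀ ∧ ∀ M : ℝ, M₀ ≤ M → ∃ (cR : ℝ) (K : ℕ), 0 < cR ∧ ∀ᶠ β : ℝ in atTop,
      ∀ φ : GaugeConfig 3 1 SU2 → ℝ, Measurable φ → ∀ Cφ : ℝ, (∀ u, |φ u| ≤ Cφ) → (∀ u, φ u ≠ 0 → orbitDist u < 14 * powScale s β / Fintype.card (Site 3 L)) →
      cR * powScale 1 β ^ K * (Real.exp (2 * β) ^ Fintype.card (Edge 3 L)) ^ 2 * (fpZ (powScale 1 β))⁻¹ ^ 2 * ∫ u, φ u ^ 2 ∂configMeasure SU2 1 ≤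
        (btC L β (fun x : LinkSpace L => {x : LinkSpace L | linkCurry x ∈ capBalancedSet L}.indicator (fun _ => (1 : ℝ)) x * frozenProfile L (fun β' => stiffGaussExp L (β' / 2) β') (fun β' => min (1 / 40) (powScale (1 / 2) β' * btLog β')) β x) (powScale 1 β) (5 * (powScale (1 / 2) β * btLog β ^ 2)) / fpZ (powScale 1 β) / recordGamma L (fun β' => fun x : LinkSpace L => {x : LinkSpace L | linkCurry x ∈ capBalancedSet L}.indicator (fun _ => (1 : ℝ)) x * frozenProfile L (fun β'' => stiffGaussExp L (β'' / 2) β'') (fun β'' => min (1 / 40) (powScale (1 / 2) β'' * btLog β'')) β' x) β *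
          levelValue su2Rep 1 ((L : ℝ) ^ 3 * β) 0) ^ 2 * tubeNormSq (softWeight (recordChi L s 43 M β)) (boFun L φ (fun x : LinkSpace L => {x : LinkSpace L | linkCurry x ∈ capBalancedSet L}.indicator (fun _ => (1 : ℝ)) x * frozenProfile L (fun β' => stiffGaussExp L (β' / 2) β') (fun β' => min (1 / 40) (powScale (1 / 2) β' * btLog β')) β x)) := by
  haveI := isFiniteMeasure_orthoTransverse L
  obtain ⟨M₀, hM₀, hnorm⟩ := tubeNormSq_record_ge (L := L) hLz hs hs3
  refine ⟨M₀, hM₀, fun M hM => ?_⟩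
  obtain ⟨Cq, hCq, hn⟩ := hnorm M hM
  obtain ⟨C₁, K₁, hC₁, hbtC⟩ := btC_record_poly_floor (L := L)
  set G : ℝ := fpWeightBar L 1 * (orthoTransverse L).real Set.univ + 1 with hGdef
  have hG0 : 0 < G := by
    have : 0 ≤ fpWeightBar L 1 * (orthoTransverse L).real Set.univ := mul_nonneg (fpWeightBar_pos L one_pos).le measureReal_nonneg
    rw [hGdef]; linarith
  have hL1 : (1 : ℝ) ≤ L := by exact_mod_cast NeZero.one_le
  have hL3 : (1 : ℝ) ≤ (L : ℝ) ^ 3 := one_le_pow₀ hL1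
  refine ⟨C₁ ^ 2 * (Real.exp (-3) / 2000) ^ 2 / ((L : ℝ) ^ 3) ^ 9 / (2 * G), 2 * K₁ + 9, by positivity, ?_⟩
  have hrs := rStar_pos
  -- the eventual conditions: the btC floor, `C_q δ² ≤ 1/2`, `β ≥ 1`, `β ≥ 2/rStar³`
  have eCq : ∀ᶠ β : ℝ in atTop, Cq * (43 * powScale s β) ^ 2 ≤ 1 / 2 := by
    have h := ((tendsto_powScale hs).const_mul 43).pow 2 |>.const_mul Cq
    rw [mul_zero, zero_pow two_ne_zero, mul_zero] at h
    exact h.eventually (eventually_le_nhds (by norm_num))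
  filter_upwards [hn, hbtC, eCq, eventually_ge_atTop (1 : ℝ), eventually_ge_atTop (2 / rStar ^ 3)] with β hnβ' hbtCβ hCqβ hβ1 hβr φ hφm Cφ hCφ hφs
  obtain ⟨-, hnβ⟩ := hnβ'
  have hβ0 : 0 ≤ β := by linarith
  -- the data
  set B : ℝ := (L : ℝ) ^ 3 * β with hBdef
  have hB1 : 1 ≤ B := by rw [hBdef]; nlinarith
  have hB2 : 2 / rStar ^ 3 ≤ B := by
    rw [hBdef]; have : 0 ≤ 2 / rStar ^ 3 := by positivity
    nlinarith
  have hB0 : 0 < B := by linarith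
  have hlam := levelValue_one_site_zero_ge hB1 hB2
  have hZ0 : 0 < fpZ (powScale 1 β) := fpZ_pos (powScale_pos 1 β)
  have hγ0 := recordGamma_record_pos (L := L) hβ0
  have hγG : recordGamma L (fun β' => fun x : LinkSpace L => {x : LinkSpace L | linkCurry x ∈ capBalancedSet L}.indicator (fun _ => (1 : ℝ)) x * frozenProfile L (fun β'' => stiffGaussExp L (β'' / 2) β'') (fun β'' => min (1 / 40) (powScale (1 / 2) β'' * btLog β'')) β' x) β ≤ G := by
    have := recordGamma_le_fpWeightBar_one (L := L) β; rw [hGdef]; linarith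
  have hI : 0 ≤ ∫ u, φ u ^ 2 ∂configMeasure SU2 1 := integral_nonneg fun u => sq_nonneg _
  have hT : 1 / 2 * recordGamma L (fun β' => fun x : LinkSpace L => {x : LinkSpace L | linkCurry x ∈ capBalancedSet L}.indicator (fun _ => (1 : ℝ)) x * frozenProfile L (fun β'' => stiffGaussExp L (β'' / 2) β'') (fun β'' => min (1 / 40) (powScale (1 / 2) β'' * btLog β'')) β' x) β * ∫ u, φ u ^ 2 ∂configMeasure SU2 1 ≤ tubeNormSq (softWeight (recordChi L s 43 M β)) (boFun L φ (fun x : LinkSpace L => {x : LinkSpace L | linkCurry x ∈ capBalancedSet L}.indicator (fun _ => (1 : ℝ)) x * frozenProfile L (fun β' => stiffGaussExp L (β' / 2) β') (fun β' => min (1 / 40) (powScale (1 / 2) β' * btLog β')) β x)) := by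
    have h := hnβ φ hφm Cφ hCφ hφs
    have h2 : 1 / 2 * recordGamma L (fun β' => fun x : LinkSpace L => {x : LinkSpace L | linkCurry x ∈ capBalancedSet L}.indicator (fun _ => (1 : ℝ)) x * frozenProfile L (fun β'' => stiffGaussExp L (β'' / 2) β'') (fun β'' => min (1 / 40) (powScale (1 / 2) β'' * btLog β'')) β' x) β * ∫ u, φ u ^ 2 ∂configMeasure SU2 1 ≤
        (1 - Cq * (43 * powScale s β) ^ 2) * recordGamma L (fun β' => fun x : LinkSpace L => {x : LinkSpace L | linkCurry x ∈ capBalancedSet L}.indicator (fun _ => (1 : ℝ)) x * frozenProfile L (fun β'' => stiffGaussExp L (β'' / 2) β'') (fun β'' => min (1 / 40) (powScale (1 / 2) β'' * btLog β'')) β' x) β * ∫ u, φ u ^ 2 ∂configMeasure SU2 1 := by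
      have := mul_le_mul_of_nonneg_right (mul_le_mul_of_nonneg_right (show (1 : ℝ) / 2 ≤ 1 - Cq * (43 * powScale s β) ^ 2 by linarith) hγ0.le) hI
      exact this
    exact h2.trans h
  have hps1 : powScale 1 β = β⁻¹ := by rw [powScale_eq hβ1, Real.rpow_neg_one]
  -- the floor of `λ₀`: `e^{6B}e^{-3}B^{-9/2}/2000`, squared `= (e^{2β})^{2|E|}·(e^{-3}/2000)²·β^{-9}/L^{27}`
  have hlamF0 : 0 ≤ Real.exp (6 * B) * (Real.exp (-3) * B ^ (-(9 : ℝ) / 2) / 2000) :=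
    mul_nonneg (Real.exp_pos _).le (div_nonneg (mul_nonneg (Real.exp_pos _).le (Real.rpow_nonneg hB0.le _)) (by norm_num))
  have hC₁K : 0 ≤ C₁ * powScale 1 β ^ K₁ := mul_nonneg hC₁.le (pow_nonneg (powScale_pos 1 β).le _)
  have key := currency_floor_alg_inv hC₁K hbtCβ hlamF0 hlam hZ0 hγ0 hγG hI hT
  -- identify the left-hand sides
  have hBpow : (B ^ (-(9 : ℝ) / 2)) ^ 2 = powScale 1 β ^ 9 / ((L : ℝ) ^ 3) ^ 9 := by
    rw [← Real.rpow_natCast, ← Real.rpow_mul hB0.le]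
    norm_num
    rw [hps1, hBdef]
    field_simp
  have hE : Real.exp (6 * B) = Real.exp (2 * β) ^ Fintype.card (Edge 3 L) := by rw [exp_two_pow_card_edge]
  have hlhs : C₁ ^ 2 * (Real.exp (-3) / 2000) ^ 2 / ((L : ℝ) ^ 3) ^ 9 / (2 * G) * powScale 1 β ^ (2 * K₁ + 9) * (Real.exp (2 * β) ^ Fintype.card (Edge 3 L)) ^ 2 *
        (fpZ (powScale 1 β))⁻¹ ^ 2 * ∫ u, φ u ^ 2 ∂configMeasure SU2 1 =
      (C₁ * powScale 1 β ^ K₁) ^ 2 * (Real.exp (6 * B) * (Real.exp (-3) * B ^ (-(9 : ℝ) / 2) / 2000)) ^ 2 / (2 * G) * (fpZ (powScale 1 β))⁻¹ ^ 2 * ∫ u, φ u ^ 2 ∂configMeasure SU2 1 := by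
    have e1 : (Real.exp (6 * B) * (Real.exp (-3) * B ^ (-(9 : ℝ) / 2) / 2000)) ^ 2 =
        (Real.exp (2 * β) ^ Fintype.card (Edge 3 L)) ^ 2 * (Real.exp (-3) / 2000) ^ 2 * (B ^ (-(9 : ℝ) / 2)) ^ 2 := by rw [hE]; ring
    rw [e1, hBpow, pow_add, pow_mul]
    field_simp
    ring
  rw [hlhs]
  exact key

end Summit.QuantumFields.YangMills.Theorems.FemtoTransferGap.TwoLattice.ConstTube

end
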